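import Summits.QuantumFields.YangMills.Theorems.UnitScaleTiltHalvingP1FlatCoreTopSizes
import Summits.QuantumFields.YangMills.Theorems.UnitScaleTiltHalvingP1FlatCoreTopSizesChart
import HarnessLib

/-!
# `hP1room` PROGRAMME (LEAD-H «H = hSupU» BOARD v2, RULING L-10 [R-h]; ★w3-20520 g6 15:53:34Z «[R-h]-b»): ★★★ THE [R-h] WIRING FROM THE TOP-STEP CALL's OUTPUT —
# the door's `hX1 hX2` rows for `X₀ := logCfg η W^λ` FROM Theorem 4's datum `(u₁, W, A)` at level `k − 1`, the top step's `λ` ((sa) + (1.108)), the two guard rows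
# `Restr129`∕`Lan` of the composite gauge, and Proposition 3's standing inputs (✓`levelCubeSizes_of_prop3_top` pass-through)

Route `UnitScaleTilt`, crux K1 child «MinimiserStabilityRegPr» (stmt-QuantumFields-19200), registered stub `stub_halvingStep` (`BirthV10`), text
`hP1room ⟸ hSupU ⟸` nine content rows (✓p643656); row [R-h] = ✓p644380∕✓p644717 (Prop 3 caller) ← ✓p645427 (chart row, guards, level shift) ← THIS FILE (the wiring).
Cell `ym3-torus` (HUMAN RULING D-0037: YM₃ on T³ is ladder rung R3 — NOT d = 4, NOT a mass gap, NOT the Clay problem), width seat `ym-ust-19200-w6` gen 2.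
`--supports stmt-QuantumFields-19200 --as helper`; THEOREMS ONLY (0 `def`, 0 `sorry`); count-neutral; nothing here claims `core′`, `hP1room`, `hSupU`, the stub, the crux or the gap.

THE ONE LETTER DECISION.  Proposition 3's datum is the gauge-fixed DATUM field `W′ := W^{(e^{iλ})⁻¹} = mgauge 1 (gaugeExp λ)⁻¹ W`, for which the global moving-frame row
`(W′)^{u₁e^{iλ}} = U′` holds with no side condition (✓`datumGuards_gaugeFixed`); `W′` agrees with the door's `W^λ := mgauge 1 (gaugeExp λ)⁻¹ (cfgExp η A)` — and `logCfg η W′` with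
`X₀ := logCfg η W^λ` — BOND-WISE on every side touching some `Ω_j` (`mgauge_apply` reads `W` at that bond only; there `W = e^{iηA}` by the datum row), which covers every bond the
level-cube rows evaluate (`z ∈ □_j ⊆ Ω_j`, `z + e_{ν′} ∈ □_0 ⊆ Ω_0`).  So the OUTPUT is stated for `X₀` VERBATIM.
WHAT.  ★★★`hX_of_topRows` (generic `ℤᵈ`, `d ≥ 2`, C⋆-algebra `𝔸`, flat background, `1 ≤ k`): the (hX1)∕(hX2) pair of ✓`HalvingP1FlatCoreWindowSizes.hsize_of_windowSizes` ∕
✓p643656's `hX1 hX2` for `X₀`, constant `c := c⋆ = 5dLB₀(α₀+α₁)` (Proposition 3's improved constant).  No new window: `α₄ ≤ 1∕84` and `L·c⋆ ≤ 1∕12` for ✓`bond_1110_local` follow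
from Proposition 3's own `16·(2(L·c⋆) + 8α₄) ≤ 1`.
HONEST SCOPE.  Wiring by name; DISPLAYED exactly as upstream: (1.33)∕(1.34) `InAk`, the level-`k` (1.42) clause `H42` (⟸ ✓`P1FlatCoreTopH42.H42_top_guarded`, ★w8-19936 g3) and (1.59)
in-edge `H59` ([4] Thm 3.3), Prop 3's windows, the datum block (⟸ [R-i] `datum_of_preGauge`, ★w3-19200 g7), the top step's rows (⟸ ✓p646092 `topRows_of_datum`), `Restr129` of the
composite gauge ((lo) → (1.29) inversion, N05's JOIN-B brick) and `Lan k W′` (⟸ ✓p645467 [R-d]).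

References: T. Bałaban, CMP **99** (1985) 75–102 [Balaban1985RegularSpaces] (Prop. 3 p.87, (1.62) p.87, (1.36) p.82, Thm 4 p.88, (1.108) p.94, (1.110)–(1.111) p.95);
CMP **102** (1985) 277–309 [Balaban1985Variational] ((144) p.300, (152) p.301).
-/

set_option autoImplicit false

noncomputable section

open scoped BigOperators
open NormedSpace

namespace Summit.QuantumFields.YangMills.Theorems.HalvingP1FlatCoreTopSizes

open Literature.MathematicalPhysics.QuantumFieldTheory.Balaban1983to89
open Complex (I)
open MatrixLog B7Prop1Explicit B7Prop2Explicit B7Prop1Local B7Eq92Concrete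
open B7Prop1Explicit renaming Site → LSite
open B8Lemma1NonAbelian (mulCfg)
open B8Ineq132 (covDerivFwd InAk)
open B8Eq140Level (SideTouches)
open B8Eq119TwistedAxial (Restr129)
open B8Eq184Proof (gaugeExp cfgExp)
open B8Eq146AExpansion (iEta)
open B8Eq138LandauZd (logCfg)
open B7Prop4GeneralLevels (logCovIter linCovIter)
open B8Eq155JBound (Jcur wsup)
open B8ScaledSupNorm (bondNorm msup)
open B7Prop3Flat (c3)
open B8Eq131Cubes (cube)
open HalvingP1FlatCoreWindowSizesOfSideTouches (sideTouches_of_mem)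

variable {d : ℕ} {𝔸 : Type*} [CStarAlgebra 𝔸] [Nontrivial 𝔸]

/-- ★★★ **THE [R-h] WIRING: THE DOOR's SIZE ROWS FOR `X₀ := logCfg η W^λ` FROM THEOREM 4's DATUM AND THE TOP STEP's `λ`.**  Inputs: Proposition 3's standing rows at the flat
background (✓`levelCubeSizes_of_prop3_top`'s, passed through verbatim: `U′` unitary, windows at `α₂ = 2(L·c⋆) + 8α₄`, `Ω Λs Λb hbox`, (1.33) `h33`, (1.34) `h34`, `Lan`, the level-`k`
sockets `H42`∕`H59`), `Ω` antitone, `□_j := cube L a M′ ρ′ k j ⊆ Ω_j`; Theorem 4's datum at level `k − 1` (`u₁` unitary-valued, `W^{u₁} = U′`, and on the sides touching `Ω_j`, `j ≤ k−1`: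
`W = e^{iηA}`, `A` self-adjoint, `‖A‖ ≤ c⋆(Lʲη)⁻¹`); the top step's `λ` (self-adjoint; (1.108) on the sides touching `Ω_j`, `j ≤ k`); and the two guards of the composite gauge
`u₁e^{iλ}` — (1.29) `Restr129 L k (Λs k) 1 (u₁·gaugeExp λ)` and `Lan k W′`, `W′ := mgauge 1 (gaugeExp λ)⁻¹ W`.  Output: the (hX1)∕(hX2) pair for `X₀ := logCfg η (mgauge 1 (gaugeExp λ)⁻¹ (cfgExp η A))`
with `c := c⋆`.  Proof: ✓`datumGuards_gaugeFixed` (`hu`, `hW`), ✓`inputRow_levelShift` + ✓`hWA_gaugeFixed_of_sizes` (the a priori chart row, transported from `W^λ` to `W′` bond-wise on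
the sides), ✓`levelCubeSizes_of_prop3_top`, and the bond-wise transport `logCfg η W′ = X₀` back on the cube bonds.
[cite: Balaban1985RegularSpaces, Prop. 3 (1.62) p.87, Thm 4 p.88, (1.108) p.94, (1.110)-(1.111) p.95, (1.36) p.82] -/
theorem hX_of_topRows (hd2 : 2 ≤ d) {η : ℝ} (hη : 0 < η) {L : ℕ} (hL : 2 ≤ L) {k : ℕ} (hk1 : 1 ≤ k)
    {U' : LSite d → Fin d → 𝔸ˣ} (hU' : ∀ x κ, U' x κ ∈ unitaryUnits 𝔸)
    {α₀ α₁ α₄ B₀ cstar : ℝ} (hα₀ : 0 < α₀) (hα₁ : 0 ≤ α₁) (hα₄ : 0 ≤ α₄) (hB₀ : 0 ≤ B₀)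
    (hc : cstar = 5 * d * L * B₀ * (α₀ + α₁))
    (hα3 : C0 d * α₀ ≤ 1 / 3) (hα4 : 4 * α₀ ≤ c2' d L)
    (h16 : 16 * (2 * (L * cstar) + 8 * α₄) ≤ 1) (hd5 : 5 * (2 * (L * cstar) + 8 * α₄) * ((d : ℝ) - 1) ≤ 4)
    (hsmall : Real.exp (4 * (800 * ((d : ℝ) + 1) ^ 2 * ((d : ℝ) + 4)) * α₀)
      * (1 + 8 * (131072 * ((d : ℝ) + 1) ^ 2) * (2 * (L * cstar) + 8 * α₄)) ≤ 2)
    (hc₃ : 2 * (2 * (L * cstar) + 8 * α₄) ≤ c3 d L) (hside : 36 * d * B₀ * (2 * (L * cstar) + 8 * α₄) ≤ 1 / 2)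
    (h50 : 50 * d * (2 * (L * cstar) + 8 * α₄) ≤ 1)
    {C₂ : ℝ} (hC₂ : 8 * (131072 * ((d : ℝ) + 1) ^ 2) * Real.exp (4 * (800 * ((d : ℝ) + 1) ^ 2 * ((d : ℝ) + 4)) * α₀) ≤ C₂)
    (h61 : 2 * (2 * (L * cstar) + 8 * α₄) ^ 2 + 20 * d * α₀ * (2 * (L * cstar) + 8 * α₄)
      + 2 * C₂ * (2 * (L * cstar) + 8 * α₄) ^ 2 ≤ α₀ + α₁)
    (Ω : ℕ → Set (LSite d)) (hΩanti : ∀ j, Ω (j + 1) ⊆ Ω j) (Λs : ℕ → ℕ → Set (LSite d)) (Λb : ℕ → ℕ → Set (LSite d × Fin d))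
    (hbox : ∀ j, j ≤ k → ∀ c ∈ Λb k j, ∀ x, InBox (loK L j c.1) (bondHiK L j c.1 c.2) x → x ∈ Ω j)
    (h33 : InAk L k η α₀ Ω (1 : LSite d → Fin d → 𝔸ˣ)) (h34 : InAk L k η α₀ Ω (mulCfg U' (1 : LSite d → Fin d → 𝔸ˣ)))
    (Lan : ℕ → (LSite d → Fin d → 𝔸ˣ) → Prop)
    (H42 : ∀ (u : LSite d → 𝔸ˣ) (W : LSite d → Fin d → 𝔸ˣ) (A' : LSite d → Fin d → 𝔸),
      (∀ x, u x ∈ unitaryUnits 𝔸) → mgauge (1 : LSite d → Fin d → 𝔸ˣ) u W = U' → Restr129 L k (Λs k) (1 : LSite d → Fin d → 𝔸ˣ) u → Lan k W →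
      (∀ y τ, IsSelfAdjoint (A' y τ)) →
      (∀ j, j ≤ k → ∀ y τ, SideTouches (Ω j) y τ →
        W y τ = cfgExp η A' y τ ∧ ‖A' y τ‖ ≤ (2 * (L * cstar) + 8 * α₄) * ((L : ℝ) ^ j * η)⁻¹) →
      (∀ y τ, (∀ j, j ≤ k → ¬ SideTouches (Ω j) y τ) → A' y τ = 0) →
      ∀ j, j ≤ k → ∀ c ∈ Λb k j, ‖logCovIter L (1 : LSite d → Fin d → 𝔸ˣ) (iEta η A') j c.1 c.2‖ < 2 * d * L * α₁)
    (H59 : ∀ (u : LSite d → 𝔸ˣ) (W : LSite d → Fin d → 𝔸ˣ) (A' : LSite d → Fin d → 𝔸),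
      (∀ x, u x ∈ unitaryUnits 𝔸) → mgauge (1 : LSite d → Fin d → 𝔸ˣ) u W = U' → Restr129 L k (Λs k) (1 : LSite d → Fin d → 𝔸ˣ) u → Lan k W →
      (∀ y τ, IsSelfAdjoint (A' y τ)) →
      (∀ j, j ≤ k → ∀ y τ, SideTouches (Ω j) y τ →
        W y τ = cfgExp η A' y τ ∧ ‖A' y τ‖ ≤ (2 * (L * cstar) + 8 * α₄) * ((L : ℝ) ^ j * η)⁻¹) →
      (∀ y τ, (∀ j, j ≤ k → ¬ SideTouches (Ω j) y τ) → A' y τ = 0) →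
      msup L k η (-(1 : ℝ)) (fun j (b : LSite d × Fin d) => SideTouches (Ω j) b.1 b.2) (fun b => A' b.1 b.2)
          ≤ B₀ * (bondNorm L k η (-(3 : ℝ)) Ω (fun x μ => Jcur η (1 : LSite d → Fin d → 𝔸ˣ) A' μ x)
            + wsup 1 (fun p : {p : ℕ × (LSite d × Fin d) // p.1 ≤ k ∧ p.2 ∈ Λb k p.1} =>
                linCovIter L (1 : LSite d → Fin d → 𝔸ˣ) (iEta η A') p.1.1 p.1.2.1 p.1.2.2)) ∧
        msup L k η (-(2 : ℝ)) (fun j (t : Fin d × Fin d × LSite d) => SideTouches (Ω j) t.2.2 t.2.1)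
            (fun t => covDerivFwd η (1 : LSite d → Fin d → 𝔸ˣ) t.1 (fun z => A' z t.2.1) t.2.2)
          ≤ B₀ * (bondNorm L k η (-(3 : ℝ)) Ω (fun x μ => Jcur η (1 : LSite d → Fin d → 𝔸ˣ) A' μ x)
            + wsup 1 (fun p : {p : ℕ × (LSite d × Fin d) // p.1 ≤ k ∧ p.2 ∈ Λb k p.1} =>
                linCovIter L (1 : LSite d → Fin d → 𝔸ˣ) (iEta η A') p.1.1 p.1.2.1 p.1.2.2)))
    -- Theorem 4's datum at level `k − 1`
    (u₁ : LSite d → 𝔸ˣ) (W : LSite d → Fin d → 𝔸ˣ) (A : LSite d → Fin d → 𝔸)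
    (hu₁ : ∀ x, u₁ x ∈ unitaryUnits 𝔸) (hWd : mgauge (1 : LSite d → Fin d → 𝔸ˣ) u₁ W = U')
    (hdat : ∀ j, j ≤ k - 1 → ∀ (y : LSite d) (τ : Fin d), SideTouches (Ω j) y τ →
      W y τ = cfgExp η A y τ ∧ IsSelfAdjoint (A y τ) ∧ ‖A y τ‖ ≤ cstar * ((L : ℝ) ^ j * η)⁻¹)
    -- the top step's `λ`
    (lam : LSite d → 𝔸) (hsa : ∀ x, IsSelfAdjoint (lam x))
    (h108 : ∀ j, j ≤ k → ∀ (y : LSite d) (τ : Fin d), SideTouches (Ω j) y τ →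
      ‖lam y‖ ≤ α₄ ∧ ((L : ℝ) ^ j * η) * ‖covDerivFwd η (1 : LSite d → Fin d → 𝔸ˣ) τ lam y‖ ≤ α₄)
    -- the two guards of the composite gauge (displayed)
    (h129 : Restr129 L k (Λs k) (1 : LSite d → Fin d → 𝔸ˣ) (u₁ * gaugeExp lam))
    (hLan : Lan k (mgauge (1 : LSite d → Fin d → 𝔸ˣ) (gaugeExp lam)⁻¹ W))
    -- the level cubes inside the domains
    {a : LSite d} {M' ρ' : ℕ} (hΩ : ∀ j, j ≤ k → cube L a M' ρ' k j ⊆ Ω j) :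
    (∀ j, j ≤ k → ∀ z ∈ cube L a M' ρ' k j, ∀ ν : Fin d,
      (L : ℝ) ^ j * η * ‖logCfg η (mgauge (1 : LSite d → Fin d → 𝔸ˣ) (gaugeExp lam)⁻¹ (cfgExp η A)) z ν‖ ≤ cstar) ∧
    (∀ j, j ≤ k → ∀ z ∈ cube L a M' ρ' k j, ∀ ν ν' : Fin d, z + e ν' ∈ cube L a M' ρ' k 0 →
      ((L : ℝ) ^ j * η) ^ 2 * η⁻¹ *
        ‖logCfg η (mgauge (1 : LSite d → Fin d → 𝔸ˣ) (gaugeExp lam)⁻¹ (cfgExp η A)) (z + e ν') ν -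
          logCfg η (mgauge (1 : LSite d → Fin d → 𝔸ˣ) (gaugeExp lam)⁻¹ (cfgExp η A)) z ν‖ ≤ cstar) := by
  have hL1 : 1 ≤ L := le_trans (by norm_num) hL
  have hLr : (1 : ℝ) ≤ L := by exact_mod_cast hL1
  have hcstar : 0 ≤ cstar := by rw [hc]; positivity
  -- the two windows of (1.110) follow from Proposition 3's `16·α₂ ≤ 1`
  have hs₁ : α₄ ≤ 1 / 84 := by nlinarith [mul_nonneg (show (0:ℝ) ≤ L by positivity) hcstar]
  have hs₂ : (L : ℝ) * cstar ≤ 1 / 12 := by nlinarith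
  -- letters: the gauge-fixed DATUM field `W′` and the door's `W^λ`
  set W' : LSite d → Fin d → 𝔸ˣ := mgauge (1 : LSite d → Fin d → 𝔸ˣ) (gaugeExp lam)⁻¹ W with hW'def
  set Wl : LSite d → Fin d → 𝔸ˣ := mgauge (1 : LSite d → Fin d → 𝔸ˣ) (gaugeExp lam)⁻¹ (cfgExp η A) with hWldef
  -- the datum's chart clause on every side touching some `Ω_j`, `j ≤ k` (antitone `Ω`, datum at `k − 1`)
  have hchart : ∀ j, j ≤ k → ∀ (y : LSite d) (τ : Fin d), SideTouches (Ω j) y τ → W y τ = cfgExp η A y τ := by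
    intro j hj y τ hs
    rcases Nat.lt_or_ge j k with hjk | hjk
    · exact (hdat j (by omega) y τ hs).1
    · have hjk' : j = k := le_antisymm hj hjk
      have hsub : Ω j ⊆ Ω (k - 1) := by
        have h := hΩanti (k - 1)
        rw [Nat.sub_add_cancel hk1] at h
        rw [hjk']; exact h
      exact (hdat (k - 1) le_rfl y τ (B8Eq140Level.sideTouches_mono hsub hs)).1
  -- bond-wise agreement `W′ = W^λ` on those sides
  have hWW : ∀ j, j ≤ k → ∀ (y : LSite d) (τ : Fin d), SideTouches (Ω j) y τ → W' y τ = Wl y τ := by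
    intro j hj y τ hs
    rw [hW'def, hWldef, mgauge_apply, mgauge_apply, hchart j hj y τ hs]
  -- the guards `hu`, `hW` of the composite gauge (global)
  obtain ⟨hu, hW⟩ := datumGuards_gaugeFixed (1 : LSite d → Fin d → 𝔸ˣ) U' W u₁ lam hu₁ hsa hWd
  -- the a priori chart row of `W^λ`, transported to `W′`
  have h69 : ∀ j, j ≤ k → ∀ (y : LSite d) (τ : Fin d), SideTouches (Ω j) y τ → ‖A y τ‖ ≤ L * cstar * ((L : ℝ) ^ j * η)⁻¹ := by
    have h := inputRow_levelShift hη hL1 (k - 1) Ω hΩanti A hcstar fun j hj y τ hs => (hdat j hj y τ hs).2.2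
    rwa [Nat.sub_add_cancel hk1] at h
  have hWA : ∀ j, j ≤ k → ∀ (y : LSite d) (τ : Fin d), SideTouches (Ω j) y τ →
      W' y τ = cfgExp η (logCfg η W') y τ ∧ ‖logCfg η W' y τ‖ ≤ (2 * (L * cstar) + 8 * α₄) * ((L : ℝ) ^ j * η)⁻¹ := by
    intro j hj y τ hs
    obtain ⟨hexp, hbd⟩ := hWA_gaugeFixed_of_sizes hη hL1 k (1 : LSite d → Fin d → 𝔸ˣ) Ω A lam hcstar hα₄ hs₁ hs₂ h69 h108 j hj y τ hs
    have hlog : logCfg η W' y τ = logCfg η Wl y τ := by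
      simp only [logCfg, hWW j hj y τ hs]
    refine ⟨?_, by rw [hlog]; exact hbd⟩
    rw [hWW j hj y τ hs, B8Prop3GaugeFixedKLevel.cfgExp_congr_at η hlog]
    exact hexp
  -- PROPOSITION 3 at the top for the datum `(u₁e^{iλ}, W′, logCfg η W′)`
  obtain ⟨hX1, hX2⟩ := levelCubeSizes_of_prop3_top hd2 hη hL k hU' hα₀ hα₁ hα₄ hB₀ hc hα3 hα4 h16 hd5 hsmall hc₃ hside h50 hC₂ h61
    Ω Λs Λb hbox h33 h34 Lan H42 H59 (u₁ * gaugeExp lam) W' (logCfg η W') hu hW h129 hLan hWA hΩ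
  -- back to `X₀ = logCfg η W^λ` on the cube bonds
  have hX : ∀ j, j ≤ k → ∀ z ∈ cube L a M' ρ' k j, ∀ ν : Fin d, logCfg η W' z ν = logCfg η Wl z ν := fun j hj z hz ν => by
    simp only [logCfg, hWW j hj z ν (sideTouches_of_mem hd2 (hΩ j hj hz) ν)]
  refine ⟨fun j hj z hz ν => ?_, fun j hj z hz ν ν' hz' => ?_⟩
  · rw [← hX j hj z hz ν]; exact hX1 j hj z hz ν
  · rw [← hX j hj z hz ν, ← hX 0 (Nat.zero_le k) (z + e ν') hz' ν]; exact hX2 j hj z hz ν ν' hz'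

end Summit.QuantumFields.YangMills.Theorems.HalvingP1FlatCoreTopSizes

end
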